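import Summits.ValiantsHypothesis.ValiantsHypothesis.Theorems.TwoProducts.RankTwoJacobianTowerInduction

/-!
# Rank-two Jacobian, P4e: Stage E (ASSEMBLY) — ★★ `rankTwoCrudeBound` and ★★★ K13 K1 `rankTwoCompositionLaw : RankTwoCompositionLaw`

`main_bound`, `eq_C_of_S1_empty`, `aeval_C_C`, `nv_C_le`, ★ `rankTwo_bound`, `k1_arith`, ★★ `rankTwoCrudeBound : nv (P(w₁,w₂)) ≤ 2(m+1)(t⁴+3t²+3t+2) + 4`,
and the law STATED ONCE in Theorems vocabulary (crit-8 (J-i)): `def RankTwoCompositionLaw : Prop` (= g8b `Cruxes.TwoProducts.ValIdea35g8b.RankTwoCompositionLaw` verbatim, K13 K1 of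
VERDICT #26) and ★★★ `rankTwoCompositionLaw : RankTwoCompositionLaw` (`c = 5`).

P4 «TowerKernel» port (val-lit-p3 g18, desk #461 (D)/#465 (C); critic of record val-idea-crit-8 g3 CONTENT GO 03:36:15Z, VERDICT #38 «K13 K1
`rankTwoCompositionLaw` KERNEL ✓») of `section TowerKernel` (l.645–1593) of val-idea-35 g9's crux workfile `Cruxes/TwoProducts/RankTwoJacobian_val_idea_35_g9.lean`
@a021fde990ed (sha16 2c954d16062836ab, 1595 l., 0 sorry) — bodies VERBATIM, namespace `…Cruxes.TwoProducts.ValIdea35g9` → `…Theorems.TwoProducts.RankTwoJacobian`,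
split at the Stage seams for the 400-line lint (TowerCharts = charts + Stage A; TowerExceptional = Stage C up to `Eset`; TowerSpecials = Stage C from `Spec`;
TowerInduction = Stages D + B; Tower = Stage E + K1), one-line docstrings added where the workfile had none; over ✓ P1–P3 `…RankTwoJacobian{,Ostrowski,Axial}`.
HONEST LABEL: K13 K1 = the decided sub-class «affine table rank ≤ 2» of the SIDE ladder «table-rank-ladder» of crux `stmt-ValiantsHypothesis-5906` (`TwoProducts`);
0 distance on `ResidualLawV25`; nothing here closes 5906 / `PlanarCellBound`; VP ≠ VNP is NOT proved.  `--supports stmt-ValiantsHypothesis-5906 --as helper`.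
Credit: val-idea-35 g9 (everything).  No instances, no notation, no named facts. [folklore]
-/

noncomputable section
set_option linter.dupNamespace false

namespace Summit.ValiantsHypothesis.ValiantsHypothesis.Theorems.TwoProducts.RankTwoJacobian

open scoped BigOperators Pointwise
open MvPolynomial

section TowerKernel
open scoped Classical

/-- VERBATIM restatement of `Cruxes.TwoProducts.ValIdea35g8b.RankTwoCompositionLaw` (K13 K1, the open toy of record of
VERDICT #26): `Newt P(w₁,w₂)` has `poly(m,t)` vertices.  PROVED IN THE KERNEL below (`rankTwoCompositionLaw`, `c = 5`;
the memo's arc count gives `c = 2` on paper).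
(VERDICT #28 (J-i)): the two decls agree by `Iff.rfl` in any file importing both workfiles — `Cruxes/` modules are not in
the farm build (`lean check` of such a bridge answers `remote:stale:unbuilt`), so the bridge is recorded here and the
Theorems-lane port should state the law ONCE, against `Theses.NewtonUnitEquations` vocabulary.) -/
def RankTwoCompositionLaw : Prop :=
  ∃ c : ℕ, ∀ (m t : ℕ) (P : Poly2) (w₁ w₂ : Poly2),
    P.totalDegree ≤ m → w₁.support.card ≤ t → w₂.support.card ≤ t →
    nv (MvPolynomial.aeval ![w₁, w₂] P) ≤ (m + 2) ^ c * (t + 2) ^ c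


/-! ### Stage E: assembly -/

/-- **Stage E.** The main bound, abstract in the chain rule / Ostrowski / axial transfer data. [val-idea-35 g9] -/
theorem main_bound (w₁ w₂ J : Poly2) (Jf : Poly2 → Poly2)
    (hAT : ∀ (ν : Fin 2 → ℝ) (F : Poly2) (e : Expo), F ≠ 0 → IsAxialLead ν w₁ e → IsEdgeDir ν F →
      IsSpecial ν F e ∨ IsEdgeDir ν (Jf F))
    (hCR : ∀ Q : Poly2, Jf (aeval ![w₁, w₂] Q) = aeval ![w₁, w₂] (pderiv 1 Q) * J)
    (hO : ∀ (ν : Fin 2 → ℝ) (F G : Poly2), F ≠ 0 → G ≠ 0 →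
      (IsEdgeDir ν (F * G) ↔ IsEdgeDir ν F ∨ IsEdgeDir ν G))
    (hS : (S1 w₁).Nonempty) (P : Poly2) (m t : ℕ) (hP : P.totalDegree ≤ m)
    (h1 : w₁.support.card ≤ t) (hJ : J.support.card ≤ t * t) :
    nv (aeval ![w₁, w₂] P) ≤ 2 * ((m + 1) * (3 * (t * t + t) + 2 + (t * t) * (t * t))) + 4 := by
  have hdeg : ∀ s ∈ P.support, s 1 < m + 1 :=
    fun s hs => lt_of_lt_of_le (deg1_lt_of_totalDegree P s hs) (by omega)
  have hX : ∀ σ : ℝ, (Xc σ w₁).card ≤ t * t + t :=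
    fun σ => (card_Xc_le σ w₁).trans (Nat.add_le_add (Nat.mul_le_mul h1 h1) h1)
  have hEJ : ∀ σ : ℝ, (Eset σ J).card ≤ (t * t) * (t * t) :=
    fun σ => (card_Eset_le σ J).trans (Nat.mul_le_mul hJ hJ)
  have T1 := tower (σ := 1) (Or.inl rfl) w₁ w₂ J Jf hAT hCR hO hS (m + 1) P hdeg
  have T2 := tower (σ := -1) (Or.inr rfl) w₁ w₂ J Jf hAT hCR hO hS (m + 1) P hdeg
  have hn := nv_le (aeval ![w₁, w₂] P)
  have K1 : 3 * (Xc 1 w₁).card + 2 + (Eset 1 J).card ≤ 3 * (t * t + t) + 2 + (t * t) * (t * t) := by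
    have := hX 1; have := hEJ 1; omega
  have K2 : 3 * (Xc (-1) w₁).card + 2 + (Eset (-1) J).card ≤ 3 * (t * t + t) + 2 + (t * t) * (t * t) := by
    have := hX (-1); have := hEJ (-1); omega
  have b1 := T1.trans (Nat.mul_le_mul_left (m + 1) K1)
  have b2 := T2.trans (Nat.mul_le_mul_left (m + 1) K2)
  omega

/-- A polynomial with no non-constant monomial is a constant. [folklore] -/
theorem eq_C_of_S1_empty {w : Poly2} (h : ¬ (S1 w).Nonempty) : w = C (coeff 0 w) := by
  have hsub : ∀ s ∈ w.support, s = 0 := by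
    intro s hs; by_contra hne; exact h ⟨s, mem_S1.mpr ⟨hs, hne⟩⟩
  rw [MvPolynomial.ext_iff]
  intro d
  by_cases hd : d = 0
  · subst hd; simp [coeff_C]
  · rw [coeff_C, if_neg (fun h => hd h.symm)]
    by_contra hne
    exact hd (hsub d (MvPolynomial.mem_support_iff.mpr hne))

/-- Composing with two constants gives a constant. [folklore] -/
theorem aeval_C_C (c₁ c₂ : ℂ) (P : Poly2) : ∃ a : ℂ, aeval ![(C c₁ : Poly2), C c₂] P = C a := by
  induction P using MvPolynomial.induction_on with
  | C a => exact ⟨a, by simp⟩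
  | add p q hp hq =>
    obtain ⟨a, ha⟩ := hp; obtain ⟨b, hb⟩ := hq
    exact ⟨a + b, by rw [map_add, ha, hb, C_add]⟩
  | mul_X p i hp =>
    obtain ⟨a, ha⟩ := hp
    refine ⟨a * (![c₁, c₂] i), ?_⟩
    rw [map_mul, ha, aeval_X, C_mul]
    fin_cases i <;> simp

/-- A constant has at most one vertex. [folklore] -/
theorem nv_C_le (a : ℂ) : nv (C a : Poly2) ≤ 1 := by
  unfold nv
  have hsub : ((C a : Poly2).support : Set Expo) ⊆ {0} := by
    intro s hs
    have hs' : s ∈ (C a : Poly2).support := hs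
    rw [MvPolynomial.mem_support_iff, coeff_C] at hs'
    by_contra hne
    exact hs' (if_neg (fun h => hne h.symm))
  have h2 : emb '' ((C a : Poly2).support : Set Expo) ⊆ {emb 0} := by
    rintro _ ⟨s, hs, rfl⟩; exact congrArg emb (hsub hs)
  have h3 : Set.extremePoints ℝ (convexHull ℝ (emb '' ((C a : Poly2).support : Set Expo))) ⊆ {emb 0} :=
    extremePoints_convexHull_subset.trans h2
  exact (Set.ncard_le_ncard h3 (Set.finite_singleton _)).trans (by rw [Set.ncard_singleton])

/-- THE TOWER THEOREM, abstract in the toric Jacobian `jac'` through its four kernel properties. -/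
theorem rankTwo_bound (jac' : Poly2 → Poly2 → Poly2)
    (hAT : ∀ (ν : Fin 2 → ℝ) (F w : Poly2) (e : Expo), F ≠ 0 → IsAxialLead ν w e → IsEdgeDir ν F →
      IsSpecial ν F e ∨ IsEdgeDir ν (jac' F w))
    (hCR : ∀ (P w₁ w₂ : Poly2), jac' (aeval ![w₁, w₂] P) w₁ = aeval ![w₁, w₂] (pderiv 1 P) * jac' w₂ w₁)
    (hO : ∀ (ν : Fin 2 → ℝ) (F G : Poly2), F ≠ 0 → G ≠ 0 →
      (IsEdgeDir ν (F * G) ↔ IsEdgeDir ν F ∨ IsEdgeDir ν G))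
    (hJS : ∀ (F G : Poly2), (jac' F G).support.card ≤ F.support.card * G.support.card)
    (m t : ℕ) (P w₁ w₂ : Poly2) (hP : P.totalDegree ≤ m)
    (h1 : w₁.support.card ≤ t) (h2 : w₂.support.card ≤ t) :
    nv (aeval ![w₁, w₂] P) ≤ 2 * ((m + 1) * (3 * (t * t + t) + 2 + (t * t) * (t * t))) + 4 := by
  by_cases hS1 : (S1 w₁).Nonempty
  · exact main_bound w₁ w₂ (jac' w₂ w₁) (fun F => jac' F w₁) (fun ν F e => hAT ν F w₁ e)
      (fun Q => hCR Q w₁ w₂) hO hS1 P m t hP h1 ((hJS w₂ w₁).trans (Nat.mul_le_mul h2 h1))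
  by_cases hS2 : (S1 w₂).Nonempty
  · -- swap the roles of w₁ and w₂
    set P' : Poly2 := rename (Equiv.swap (0 : Fin 2) 1) P with hP'
    have hsw : aeval ![w₁, w₂] P = aeval ![w₂, w₁] P' := by
      rw [hP', aeval_rename]
      have hfun : (![w₂, w₁] ∘ ⇑(Equiv.swap (0 : Fin 2) 1) : Fin 2 → Poly2) = ![w₁, w₂] := by
        funext i
        fin_cases i <;> simp [Equiv.swap_apply_left, Equiv.swap_apply_right]
      rw [hfun]
    have hdeg' : P'.totalDegree ≤ m := (totalDegree_rename_le _ _).trans hP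
    rw [hsw]
    exact main_bound w₂ w₁ (jac' w₁ w₂) (fun F => jac' F w₂) (fun ν F e => hAT ν F w₂ e)
      (fun Q => hCR Q w₂ w₁) hO hS2 P' m t hdeg' h2 ((hJS w₁ w₂).trans (Nat.mul_le_mul h1 h2))
  · -- both constant
    rw [eq_C_of_S1_empty hS1, eq_C_of_S1_empty hS2]
    obtain ⟨a, ha⟩ := aeval_C_C (coeff 0 w₁) (coeff 0 w₂) P
    rw [ha]
    have := nv_C_le a
    omega

/-- Arithmetic: the crude bound is `≤ (m+2)^5 (t+2)^5`. [folklore] -/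
theorem k1_arith (m t : ℕ) :
    2 * ((m + 1) * (3 * (t * t + t) + 2 + (t * t) * (t * t))) + 4 ≤ (m + 2) ^ 5 * (t + 2) ^ 5 := by
  set X := 3 * (t * t + t) + 2 + (t * t) * (t * t) with hX
  have hX5 : 2 * X + 4 ≤ (t + 2) ^ 5 := by
    have e : (t + 2) ^ 5 = t ^ 5 + 10 * t ^ 4 + 40 * t ^ 3 + 80 * t ^ 2 + 80 * t + 32 := by ring
    rw [e, hX]
    ring_nf
    nlinarith [Nat.zero_le (t ^ 5), Nat.zero_le (t ^ 4), Nat.zero_le (t ^ 3), Nat.zero_le (t ^ 2), Nat.zero_le t]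
  have hm : 2 * ((m + 1) * X) + 4 ≤ (m + 2) * (2 * X + 4) := by ring_nf; nlinarith [Nat.zero_le (m * X), Nat.zero_le X, Nat.zero_le m]
  calc 2 * ((m + 1) * X) + 4 ≤ (m + 2) * (2 * X + 4) := hm
    _ ≤ (m + 2) ^ 5 * (t + 2) ^ 5 :=
        Nat.mul_le_mul (Nat.le_self_pow (by norm_num) _) hX5



/-- THE CRUDE RANK-TWO BOUND (kernel): `nv(P(w₁,w₂)) ≤ 2(m+1)(t⁴+3t²+3t+2) + 4` for `totalDegree P ≤ m` and `t`-sparse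
`w₁, w₂` — the abstract tower `rankTwo_bound` instantiated by the kernel theorems `axialTransfer`, `chainRule`,
`ostrowski`, `jacSupportBound` of this file. -/
theorem rankTwoCrudeBound (m t : ℕ) (P w₁ w₂ : Poly2) (hP : P.totalDegree ≤ m)
    (h1 : w₁.support.card ≤ t) (h2 : w₂.support.card ≤ t) :
    nv (MvPolynomial.aeval ![w₁, w₂] P) ≤ 2 * ((m + 1) * (3 * (t * t + t) + 2 + (t * t) * (t * t))) + 4 :=
  rankTwo_bound jac axialTransfer chainRule ostrowski (fun F G => (jacSupportBound F G).1) m t P w₁ w₂ hP h1 h2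

/-- **K13 K1 IN THE KERNEL** (VERDICT #26 (U1) toy of record, g8 `RankTwoCompositionLaw` verbatim): the rank-two
composition law holds, with exponent `c = 5` (crude chart counts; the memo's arc count gives `c = 2`).
Nothing here closes 5906 / `PlanarCellBound`; VP ≠ VNP is NOT proved. -/
theorem rankTwoCompositionLaw : RankTwoCompositionLaw :=
  ⟨5, fun m t P w₁ w₂ hP h1 h2 => (rankTwoCrudeBound m t P w₁ w₂ hP h1 h2).trans (k1_arith m t)⟩


end TowerKernel

end Summit.ValiantsHypothesis.ValiantsHypothesis.Theorems.TwoProducts.RankTwoJacobian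

end
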